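import Literature.Topology.FourManifolds.HandlebodyKernelExtensionGenusOne
import Literature.Topology.FourManifolds.DehnNielsenBaerFlowerSymmetries
import HarnessLib

/-!
# Griffiths' handlebody extension theorem: reduction to based boundary diffeomorphisms

Topic `Literature/Topology/FourManifolds`; a further file on the named fact
`Literature.Topology.FourManifolds.GriffithsExtension` (`HandlebodyKernelExtension.lean`;
H. B. Griffiths, *Automorphisms of a 3-dimensional handlebody* (1964), main theorem; S. Hensel,
*A primer on handlebody groups* (2020), Cor. 5.11), after `HandlebodyKernelExtensionModel.lean`
(one model per genus, up to diffeotopy) and `HandlebodyKernelExtensionGenusOne.lean` (genus `1`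
modulo the faithfulness of `Mod(T²)`).  **Everything here is proved; no definition and no named
fact is introduced; the fact is NOT discharged.**

The base-point normalisation used inside the genus-`1` proof
(`RoundSolidTorusModel.diffeoExtends_of_map_ker_eq_ker_of_faithful`, Step 1) is valid for every
compact manifold with connected boundary and is recorded here once, in general, so that the
genus-`≥ 2` clause of the fact (Griffiths' criterion on the flower handlebodies
`FlowerModel.FlowerHandlebody`, hypothesis `h₂` of `griffithsExtension_of_roundSolidTorus_of_flower`)
may be attacked for BASED diffeomorphisms at the north pole `x₀ = FlowerModel.northPole hg` — the
base point at which the tree marks `π₁(∂V_g)` and realises its symmetries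
(`DehnNielsenBaerFlowerSymmetries.lean`):

* `BoundaryData.diffeoExtends_of_map_ker_eq_ker_of_based` — **Griffiths' criterion at one base
  point implies it everywhere**: for a compact `(n+1)`-manifold `M` with boundary datum `b` of
  connected carrier and a point `z₀ ∈ ∂M`, if every self-diffeomorphism `ψ` of `∂M` FIXING `z₀`
  and preserving `ker (π₁(∂M, z₀) → π₁ M)` extends over `M`, then every self-diffeomorphism `χ`
  preserving the kernel at some base point extends: move `y₀ ↦ z₀` and `χ y₀ ↦ z₀` by
  diffeomorphisms diffeotopic to the identity (homogeneity, Hirsch Ch. 8 §3 Thm. 3.1), which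
  extend (collar absorption, the tree's proved `BoundaryData.diffeoExtends_of_isDiffeotopicToId_holds`,
  Hirsch Ch. 8 §2) and are therefore kernel-preserving (necessity,
  `BoundaryData.DiffeoExtends.map_ker_eq_ker`), and compose (`BoundaryData.map_ker_trans`);
* `griffithsExtension_of_forall_diffeoExtends_of_flower_based` — **`GriffithsExtension` from the
  minimal genus-`1` interface (E) and the BASED flower criterion**: it suffices that, for each
  `g ≥ 2`, every self-diffeomorphism of `∂V_g` fixing the north pole and preserving
  `ker (π₁(∂V_g, x₀) → π₁ V_g)` extend over `V_g`, together with hypothesis (E) of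
  `TorusMappingClassFaithfulModel.lean` / (F) of `HandlebodyKernelExtensionGenusOne.lean` in
  genus `1` (here taken in the extension form (E));
* §3 `IsFreeOfRank.injective_of_surjective` (**free groups of finite rank are Hopfian**, from the
  tree's proved residual-finiteness argument `injective_of_surjective_of_sameFiniteQuotients`),
  `IsFreeOfRank.injective_of_surjective_of_isFreeOfRank`, and
  `Subgroup.eq_of_le_of_isFreeOfRank_quotient` — nested normal subgroups with quotients free of
  the same rank coincide: the algebraic step identifying `ker (π₁ ∂V_g → π₁ V_g)` with the normal
  closure of the meridians once the latter is known to cut `π₁ ∂V_g` down to `F_g` (Hensel (2020),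
  Cor. 5.11 ii) ⟺ iii); Lyndon–Schupp Prop. I.3.5).

## References

* H. B. Griffiths, Abh. Math. Sem. Univ. Hamburg 26 (1964) 191–210, main theorem.
  [GriffithsHB1964Handlebody]
* S. Hensel, *A primer on handlebody groups* (2020), Cor. 5.11, Lemma 5.10.
  [Hensel2020HandlebodyPrimer]
* M. W. Hirsch, *Differential Topology* (1976), Ch. 8 §2 (proof of Thm. 2.3), §3 Thm. 3.1.
  [HirschDT1976]
* A. Hatcher, *Algebraic Topology* (2002), §1.1 p. 34, Prop. 1.18. [HatcherAT2002]
* R. C. Lyndon, P. E. Schupp, *Combinatorial Group Theory* (2001), Ch. I Prop. 3.5 (free groups of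
  finite rank are Hopfian). [LyndonSchupp2001]
-/

noncomputable section

namespace Literature.Topology.FourManifolds

open Set Function
open scoped _root_.Manifold _root_.ContDiff _root_.Topology

universe u

/-! ### §1 Griffiths' criterion at one base point implies it at all base points -/

section Based

variable {n : ℕ} {M : Type u} [TopologicalSpace M] [T2Space M] [SecondCountableTopology M]
  [CompactSpace M] [ChartedSpace (EuclideanHalfSpace (n + 1)) M] [IsManifold (𝓡∂ (n + 1)) ∞ M]

/-- **Griffiths' extension criterion reduces to based diffeomorphisms.**  Let `M` be a compact
smooth `(n+1)`-manifold with boundary datum `b` whose carrier `∂M` is connected, and `z₀ ∈ ∂M`.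
If every self-diffeomorphism `ψ` of `∂M` with `ψ z₀ = z₀` whose induced map carries
`ker (π₁(∂M, z₀) → π₁ M)` onto `ker (π₁(∂M, ψ z₀) → π₁ M)` extends over `M`, then so does every
self-diffeomorphism `χ` satisfying the kernel condition at an arbitrary base point `y₀`:
`χ = P₁⁻¹ ∘ (P₂ ∘ χ ∘ P₁) ∘ P₂⁻¹` with `P₁ z₀ = y₀`, `P₂ (χ y₀) = z₀` diffeotopic to the identity
(homogeneity), hence extendable (collar) and kernel-preserving (necessity), and the middle factor
is based at `z₀` and kernel-preserving (composition).  Griffiths (1964) in any dimension; Hirsch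
(1976), Ch. 8 §2–§3. [cite: HirschDT1976, Ch. 8 §3, Thm. 3.1] -/
theorem BoundaryData.diffeoExtends_of_map_ker_eq_ker_of_based (b : BoundaryData (𝓡∂ (n + 1)) M (𝓡 n))
    [ConnectedSpace b.carrier] (z₀ : b.carrier)
    (h : ∀ (ψ : b.carrier ≃ₘ⟮𝓡 n, 𝓡 n⟯ b.carrier), ψ z₀ = z₀ →
      ((FundamentalGroup.map (⟨b.incl, b.continuous_incl⟩ : C(b.carrier, M)) z₀).ker).map
          (FundamentalGroup.map (⟨ψ, ψ.continuous⟩ : C(b.carrier, b.carrier)) z₀)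
        = (FundamentalGroup.map (⟨b.incl, b.continuous_incl⟩ : C(b.carrier, M))
            ((⟨ψ, ψ.continuous⟩ : C(b.carrier, b.carrier)) z₀)).ker →
      b.DiffeoExtends ψ)
    (χ : b.carrier ≃ₘ⟮𝓡 n, 𝓡 n⟯ b.carrier) (y₀ : b.carrier)
    (hker : ((FundamentalGroup.map (⟨b.incl, b.continuous_incl⟩ : C(b.carrier, M)) y₀).ker).map
        (FundamentalGroup.map (⟨χ, χ.continuous⟩ : C(b.carrier, b.carrier)) y₀)
      = (FundamentalGroup.map (⟨b.incl, b.continuous_incl⟩ : C(b.carrier, M))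
          ((⟨χ, χ.continuous⟩ : C(b.carrier, b.carrier)) y₀)).ker) :
    b.DiffeoExtends χ := by
  haveI : T2Space b.carrier := b.t2Space_carrier
  -- move the base points to `z₀` by diffeotopies
  obtain ⟨P₁, hP₁, hP₁x⟩ := Diffeomorph.exists_isDiffeotopicToId_apply_eq_euclidean n b.carrier z₀ y₀
  obtain ⟨P₂, hP₂, hP₂x⟩ :=
    Diffeomorph.exists_isDiffeotopicToId_apply_eq_euclidean n b.carrier (χ y₀) z₀
  have hE₁ : b.DiffeoExtends P₁ := BoundaryData.diffeoExtends_of_isDiffeotopicToId_holds n M b P₁ hP₁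
  have hE₂ : b.DiffeoExtends P₂ := BoundaryData.diffeoExtends_of_isDiffeotopicToId_holds n M b P₂ hP₂
  have hψx : ((P₁.trans χ).trans P₂) z₀ = z₀ := by
    show P₂ (χ (P₁ z₀)) = z₀
    rw [hP₁x, hP₂x]
  -- the kernel condition for `ψ = P₂ ∘ χ ∘ P₁` at `z₀`
  have hkχ : ((FundamentalGroup.map (⟨b.incl, b.continuous_incl⟩ : C(b.carrier, M)) (P₁ z₀)).ker).map
        (FundamentalGroup.map (⟨χ, χ.continuous⟩ : C(b.carrier, b.carrier)) (P₁ z₀)) =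
      (FundamentalGroup.map (⟨b.incl, b.continuous_incl⟩ : C(b.carrier, M))
        ((⟨χ, χ.continuous⟩ : C(b.carrier, b.carrier)) (P₁ z₀))).ker := by
    rw [hP₁x]; exact hker
  have hkψ := b.map_ker_trans (b.map_ker_trans (hE₁.map_ker_eq_ker z₀) hkχ)
    (hE₂.map_ker_eq_ker ((P₁.trans χ) z₀))
  -- the based diffeomorphism extends, and so does `χ`
  have hψext : b.DiffeoExtends ((P₁.trans χ).trans P₂) := h _ hψx hkψ
  have h' := (hE₁.symm.trans hψext).trans hE₂.symm
  have e : (P₁.symm.trans ((P₁.trans χ).trans P₂)).trans P₂.symm = χ := Diffeomorph.ext fun z => by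
    simp only [Diffeomorph.coe_trans, Function.comp_apply, Diffeomorph.apply_symm_apply,
      Diffeomorph.symm_apply_apply]
  rwa [e] at h'

end Based

/-! ### §2 `GriffithsExtension` from (E) in genus one and the based flower criterion -/

open RoundSolidTorusModel FlowerModel Literature.AlgebraicTopology.FundamentalGroup in
/-- **`GriffithsExtension` from the minimal genus-one interface and the BASED flower criterion.**
It suffices that (E) every self-diffeomorphism `τ` of the Heegaard torus `∂V` of the round solid
torus fixing `z₀` and acting as the identity on `π₁(∂V, z₀)` extend over `V`, and that for every
`g ≥ 2` every self-diffeomorphism `ψ` of the flower surface `∂V_g` fixing the north pole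
`x₀ = northPole hg` and carrying `ker (π₁(∂V_g, x₀) → π₁ V_g)` onto itself (read at `ψ x₀ = x₀`)
extend over `V_g`: genus `1` is `RoundSolidTorusModel.diffeoExtends_of_map_ker_eq_ker_of_faithful`'s
argument with (E) (inlined below through the collar-free bookkeeping of §1 and the realisation
`exists_diffeoExtends_mapOfEq_eq`), genus `≥ 2` is §1 at `x₀` (the flower surface is connected,
`IsHandlebody.connectedSpace_boundary_holds`), and the assembly is
`griffithsExtension_of_roundSolidTorus_of_flower`.
[cite: GriffithsHB1964Handlebody, main theorem] [cite: Hensel2020HandlebodyPrimer, Cor. 5.11] -/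
theorem griffithsExtension_of_forall_diffeoExtends_of_flower_based
    (h₁ : ∀ (χ : (𝓡∂ 3).boundary RoundSolidTorus ≃ₘ⟮𝓡 2, 𝓡 2⟯ (𝓡∂ 3).boundary RoundSolidTorus)
      (y₀ : (𝓡∂ 3).boundary RoundSolidTorus),
      ((FundamentalGroup.map bdryIncl y₀).ker).map
          (FundamentalGroup.map (⟨χ, χ.continuous⟩ : C(_, _)) y₀)
        = (FundamentalGroup.map bdryIncl ((⟨χ, χ.continuous⟩ : C(_, _)) y₀)).ker →
      (BoundaryManifold.boundaryData 2 RoundSolidTorus).DiffeoExtends χ)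
    (h₂ : ∀ (g : ℕ) (hg : 2 ≤ g)
      (ψ : (𝓡∂ 3).boundary (FlowerHandlebody hg) ≃ₘ⟮𝓡 2, 𝓡 2⟯ (𝓡∂ 3).boundary (FlowerHandlebody hg)),
      ψ (northPole hg) = northPole hg →
      ((FundamentalGroup.map (⟨(BoundaryManifold.boundaryData 2 (FlowerHandlebody hg)).incl,
          (BoundaryManifold.boundaryData 2 (FlowerHandlebody hg)).continuous_incl⟩ :
            C((𝓡∂ 3).boundary (FlowerHandlebody hg), FlowerHandlebody hg)) (northPole hg)).ker).map
          (FundamentalGroup.map (⟨ψ, ψ.continuous⟩ : C(_, _)) (northPole hg))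
        = (FundamentalGroup.map (⟨(BoundaryManifold.boundaryData 2 (FlowerHandlebody hg)).incl,
            (BoundaryManifold.boundaryData 2 (FlowerHandlebody hg)).continuous_incl⟩ :
              C((𝓡∂ 3).boundary (FlowerHandlebody hg), FlowerHandlebody hg))
            ((⟨ψ, ψ.continuous⟩ : C(_, _)) (northPole hg))).ker →
      (BoundaryManifold.boundaryData 2 (FlowerHandlebody hg)).DiffeoExtends ψ) :
    GriffithsExtension := by
  refine griffithsExtension_of_roundSolidTorus_of_flower h₁ fun g hg χ y₀ hker => ?_
  haveI := (isHandlebody_flowerHandlebody hg).compactSpace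
  haveI : ConnectedSpace (BoundaryManifold.boundaryData 2 (FlowerHandlebody hg)).carrier :=
    IsHandlebody.connectedSpace_boundary_holds g (FlowerHandlebody hg)
      (isHandlebody_flowerHandlebody hg) (BoundaryManifold.boundaryData 2 (FlowerHandlebody hg))
  exact (BoundaryManifold.boundaryData 2 (FlowerHandlebody hg)).diffeoExtends_of_map_ker_eq_ker_of_based
    (northPole hg) (fun ψ hψ hk => h₂ g hg ψ hψ hk) χ y₀ hker

/-! ### §3 Hopfian bookkeeping: the kernel of `π₁ ∂V_g → π₁ V_g` is the normal closure of any `g` classes that die in `V_g` and already cut `S_g` down to `F_g` -/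

section Hopfian

variable {G : Type*} [Group G]

/-- **Free groups of finite rank are Hopfian**, in the tree's vocabulary: an epimorphism from `F_k`
onto a group free of rank `k` is injective (a group isomorphic to `F_k` has the finite quotients
of `F_k`, so the tree's proved `injective_of_surjective_of_sameFiniteQuotients` — Mal'cev's
argument through the residual finiteness of free groups, Dixon–Formanek–Poland–Ribes Thm. 3 —
applies).  Magnus–Karrass–Solitar, *Combinatorial Group Theory* (1966), Thm. 2.13; Lyndon–Schupp
(2001), Prop. I.3.5. [cite: LyndonSchupp2001, Ch. I Prop. 3.5] -/
theorem IsFreeOfRank.injective_of_surjective {k : ℕ} (hG : IsFreeOfRank G k)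
    (φ : FreeGroup (Fin k) →* G) (hφ : Function.Surjective φ) : Function.Injective φ := by
  obtain ⟨e⟩ := hG
  refine injective_of_surjective_of_sameFiniteQuotients φ hφ fun Q _ _ => ⟨?_, ?_⟩
  · rintro ⟨f, hf⟩
    exact ⟨f.comp e.toMonoidHom, hf.comp e.surjective⟩
  · rintro ⟨f, hf⟩
    exact ⟨f.comp e.symm.toMonoidHom, hf.comp e.symm.surjective⟩

/-- **A surjection between two groups free of the same finite rank is an isomorphism.**
[cite: LyndonSchupp2001, Ch. I Prop. 3.5] -/
theorem IsFreeOfRank.injective_of_surjective_of_isFreeOfRank {H : Type*} [Group H] {k : ℕ}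
    (hH : IsFreeOfRank H k) (hG : IsFreeOfRank G k) (ψ : H →* G) (hψ : Function.Surjective ψ) :
    Function.Injective ψ := by
  obtain ⟨e⟩ := hH
  have h := hG.injective_of_surjective (ψ.comp e.toMonoidHom) (hψ.comp e.surjective)
  intro x y hxy
  obtain ⟨x, rfl⟩ := e.surjective x
  obtain ⟨y, rfl⟩ := e.surjective y
  exact congrArg e (h hxy)

/-- **Nested normal subgroups with quotients free of the same finite rank are equal.**  If
`N ≤ K` are normal in `S` and both `S ⧸ N` and `S ⧸ K` are free of rank `k`, then `K = N`: the
projection `S ⧸ N ↠ S ⧸ K` is a surjection between groups free of rank `k`, hence injective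
(Hopfian property).  USE (the first step of every proof of Griffiths' theorem on a model): with
`S = π₁(∂V_g, x₀)`, `K = ker (π₁ ∂V_g → π₁ V_g)` (quotient `π₁ V_g`, free of rank `g` — Milnor's
handle count, `IsHandlebody.isFreeOfRank_quotient_ker_map_incl`) and `N` the normal closure of the
classes of `g` meridians (curves bounding discs in `V_g`, so `N ≤ K`) for which `S ⧸ N ≅ F_g` is
known from the marking (`SurfaceGroup.cutKernel`, `HandlebodyGroupRealisation.lean`), it gives
`K = N`: **the kernel is the normal closure of the meridians**, so that "kernel-preserving" reads
"carries meridians to curves null-homotopic in `V_g`" (Hensel (2020), Cor. 5.11 ii) ⟺ iii)).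
[cite: LyndonSchupp2001, Ch. I Prop. 3.5] [cite: Hensel2020HandlebodyPrimer, Cor. 5.11] -/
theorem Subgroup.eq_of_le_of_isFreeOfRank_quotient {S : Type*} [Group S] {N K : Subgroup S}
    [N.Normal] [K.Normal] (hNK : N ≤ K) {k : ℕ} (hN : IsFreeOfRank (S ⧸ N) k)
    (hK : IsFreeOfRank (S ⧸ K) k) : K = N := by
  refine le_antisymm (fun x hx => ?_) hNK
  have hinj := hN.injective_of_surjective_of_isFreeOfRank hK (QuotientGroup.map N K (MonoidHom.id S) hNK)
    (fun y => by
      obtain ⟨s, rfl⟩ := QuotientGroup.mk_surjective y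
      exact ⟨QuotientGroup.mk s, rfl⟩)
  have h1 : QuotientGroup.map N K (MonoidHom.id S) hNK (QuotientGroup.mk x) = 1 := by
    rw [QuotientGroup.map_mk, MonoidHom.id_apply, QuotientGroup.eq_one_iff]
    exact hx
  have h2 : (QuotientGroup.mk x : S ⧸ N) = 1 := hinj (h1.trans (map_one _).symm)
  exact (QuotientGroup.eq_one_iff x).1 h2

end Hopfian

end Literature.Topology.FourManifolds

end
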